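import Summits.ABC.ABC.Theorems.IsogenyGlueCongruenceMazurKenkuBoundStubTwoVertex
import Summits.ABC.ABC.Theorems.IsogenyGlueCongruenceMazurKenkuBoundLevelTwentyDiophantine
import Literature.NumberTheory.EllipticCurves.CyclicIsogenyDegreeTwenty
import Literature.NumberTheory.EllipticCurves.KenkuMinimalLevelsKleinFrickeFiveSeven
import HarnessLib

/-!
# Crux `MazurKenkuBound` (stmt-ABC-15125), line `radius-lite` — Kenku's level `20` WITHOUT
# modular curves: no cyclic `ℚ`-isogeny of degree `20` (reduction to the fibre product
# `X₀(4) ×_{X(1)} X₀(5)` + the landed Diophantine end)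

A cyclic `20`-isogeny `ψ` out of `V` has a cyclic sub-isogeny of degree `4 = 2²`
(`Isogeny.exists_isCyclic_degree_eq_of_dvd`), whose kernel is put in two-torsion normal form
`y² = x³ + ax² + bx` on a `ℚ`-isomorphic model with the SAME `j` (the `j`-preserving form of the
landed `exists_twoTorsionNF_of_isCyclic_isogeny`, p141542; `variableChange_j`); the vertex
criterion (`twoVertex_exists_sq`, p141021, `k = 2`) gives `b = d²`, so
`j(V) · d⁴(a² − 4d²) = 256 (a² − 3d²)³` (`Δ = 16b²(a² − 4b)`, `c₄ = 16(a² − 3b)`), i.e.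
`j = 256(s² − 3)³/(s² − 4)` with `s = a/d` — the coordinate `s` of `X₀(4)`; and the degree-`5`
part gives Klein–Fricke `j = (t² + 10t + 5)³/t`, `t ≠ 0` (`exists_j_eq_klein_five_of_five_dvd_degree`).
Hence a rational solution of `256 t (s² − 3)³ = (s² − 4)(t² + 10t + 5)³` with `t ≠ 0`, `s² ≠ 4`:
an affine non-cuspidal rational point of the (genus-one) fibre product `X₀(4) ×_{X(1)} X₀(5) ≃ X₀(20)`.
Step 2, the Diophantine end (no such point: Belyĭ inversion of `X₀(10)`, the curve `20a1`, Kubert's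
determination of `X₁(2,10)(ℚ)` — tree `X1TwoTen_points`), is the landed
`…LevelTwentyDiophantine.lean` (`stub_levelTwentyNoPoint`); the assembly `stub_levelTwenty` and the
discharge `isogeny_isCyclic_degree_ne_twenty_holds` of the Literature named fact
`isogeny_isCyclic_degree_ne_twenty` (wanted by crux stmt-ABC-11340) close the file.

## References

* [Kenku1982] M. A. Kenku, J. Number Theory 15 (1982) 199–202, proof of Thm. 1 (level `20`).
* [Ligozat1975] G. Ligozat, *Courbes modulaires de genre 1*, Mém. SMF 43 (1975) (`X₀(20)`).
* [SilvermanAEC2009] J. H. Silverman, *The Arithmetic of Elliptic Curves*, 2nd ed., III.1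
  (`j = c₄³/Δ`), III.4 Example 4.5, X.4.9.
-/

-- `Summit.ABC.ABC` is the mandated summit-side namespace (CONVENTIONS §2); the duplicate is deliberate.
set_option linter.dupNamespace false

noncomputable section

open scoped Classical
open WeierstrassCurve
open Literature.NumberTheory.EllipticCurves

namespace Summit.ABC.ABC.Theorems

universe u

/-! ### Two facts on finite cyclic groups -/

/-- A finite cyclic subgroup has at most one element of order `2`: the number of elements of
order `d` in a cyclic group of order `n`, `d ∣ n`, is `φ(d)`, and `φ(2) = 1`. [folklore] -/
private theorem eq_of_two_nsmul_eq_zero_of_isAddCyclic {G : Type*} [AddCommGroup G]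
    (H : AddSubgroup G) [IsAddCyclic H] [Finite H] {P Q : G} (hP : P ∈ H) (hQ : Q ∈ H)
    (h2P : 2 • P = 0) (hP0 : P ≠ 0) (h2Q : 2 • Q = 0) (hQ0 : Q ≠ 0) : P = Q := by
  haveI := Fintype.ofFinite H
  have hP2 : addOrderOf (⟨P, hP⟩ : H) = 2 :=
    (AddSubgroup.addOrderOf_mk P hP).trans (addOrderOf_eq_prime h2P hP0)
  have hQ2 : addOrderOf (⟨Q, hQ⟩ : H) = 2 :=
    (AddSubgroup.addOrderOf_mk Q hQ).trans (addOrderOf_eq_prime h2Q hQ0)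
  have hdvd : 2 ∣ Fintype.card H := hP2 ▸ addOrderOf_dvd_card
  obtain ⟨a, ha⟩ := Finset.card_eq_one.mp
    ((IsAddCyclic.card_addOrderOf_eq_totient hdvd).trans Nat.totient_two)
  have hPa : (⟨P, hP⟩ : H) ∈ ({a} : Finset H) := by
    rw [← ha]
    exact Finset.mem_filter.mpr ⟨Finset.mem_univ _, hP2⟩
  have hQa : (⟨Q, hQ⟩ : H) ∈ ({a} : Finset H) := by
    rw [← ha]
    exact Finset.mem_filter.mpr ⟨Finset.mem_univ _, hQ2⟩
  rw [Finset.mem_singleton] at hPa hQa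
  exact congrArg Subtype.val (hPa.trans hQa.symm)

/-- A cyclic subgroup of order `2ᵏ`, `k ≥ 1`, contains an element of order `2`, namely `2ᵏ⁻¹ g`
for a generator `g`. [folklore] -/
private theorem exists_two_nsmul_eq_zero_of_card_eq {G : Type*} [AddCommGroup G]
    (H : AddSubgroup G) [IsAddCyclic H] {k : ℕ} (hk : 1 ≤ k) (hcard : Nat.card H = 2 ^ k) :
    ∃ T ∈ H, 2 • T = 0 ∧ T ≠ 0 := by
  obtain ⟨g, hg⟩ := IsAddCyclic.exists_ofOrder_eq_natCard (α := H)
  rw [hcard, ← AddSubgroup.addOrderOf_coe] at hg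
  refine ⟨2 ^ (k - 1) • (g : G), H.nsmul_mem g.2 _, ?_, ?_⟩
  · rw [smul_smul, ← pow_succ', show k - 1 + 1 = k by omega, ← hg]
    exact addOrderOf_nsmul_eq_zero _
  · intro h0
    have hdvd := addOrderOf_dvd_of_nsmul_eq_zero h0
    rw [hg, Nat.pow_dvd_pow_iff_le_right Nat.one_lt_two] at hdvd
    omega

/-! ### The `j`-preserving two-torsion normal form -/

/-- Bookkeeping: a curve `V` in two-torsion normal form *is* the literal equation
`⟨0, a₂(V), 0, a₄(V), 0⟩` (same `j`), so data on `V` are data on that equation. [folklore] -/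
private theorem exists_literal_j_of_isTwoTorsionNF {K : Type u} [Field K] (V : WeierstrassCurve K)
    [hV : V.IsTwoTorsionNF] [hE : V.IsElliptic] (C : AddSubgroup V.geomPoints) (k : ℕ)
    (hst : ∀ σ : Field.absoluteGaloisGroup K, ∀ P ∈ C, σ • P ∈ C) (hcyc : IsAddCyclic C)
    (hcard : Nat.card C = 2 ^ k)
    (h2 : ∀ P ∈ C, 2 • P = 0 → P ≠ 0 → P = V.geomTwoTorsionPoint) :
    ∃ (a b : K) (_ : (⟨0, a, 0, b, 0⟩ : WeierstrassCurve K).IsElliptic)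
      (C' : AddSubgroup (⟨0, a, 0, b, 0⟩ : WeierstrassCurve K).geomPoints),
      (⟨0, a, 0, b, 0⟩ : WeierstrassCurve K).j = V.j ∧
      (∀ σ : Field.absoluteGaloisGroup K, ∀ P ∈ C', σ • P ∈ C') ∧ IsAddCyclic C' ∧
        Nat.card C' = 2 ^ k ∧
        ∀ P ∈ C', 2 • P = 0 → P ≠ 0 →
          P = (⟨0, a, 0, b, 0⟩ : WeierstrassCurve K).geomTwoTorsionPoint := by
  obtain ⟨v₁, v₂, v₃, v₄, v₆⟩ := V
  have h₁ : v₁ = 0 := hV.a₁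
  have h₃ : v₃ = 0 := hV.a₃
  have h₆ : v₆ = 0 := hV.a₆
  subst h₁ h₃ h₆
  exact ⟨v₂, v₄, hE, C, rfl, hst, hcyc, hcard, h2⟩

/-- **Two-torsion normal form of a cyclic `2`-power isogeny kernel, with the same `j`.** The
landed `exists_twoTorsionNF_of_isCyclic_isogeny` (p141542) records the normal form
`y² = x³ + ax² + bx` up to `K`-isomorphism only; here the model is remembered to be a change of
variables of `E` (`variableChange_j`), so `j` is unchanged. Proof otherwise verbatim.
[cite: SilvermanAEC2009, III.4 Example 4.5, X.4.9] -/
theorem exists_twoTorsionNF_j_eq_of_isCyclic_isogeny {K : Type u} [Field K] [PerfectField K]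
    (htwo : (2 : K) ≠ 0) (W W' : WeierstrassCurve K) [W.IsElliptic] (ψ : Isogeny W W') {k : ℕ}
    (hk : 1 ≤ k) (hcyc : ψ.IsCyclic) (hdeg : ψ.degree = 2 ^ k) :
    ∃ (a b : K) (_ : (⟨0, a, 0, b, 0⟩ : WeierstrassCurve K).IsElliptic)
      (C : AddSubgroup (⟨0, a, 0, b, 0⟩ : WeierstrassCurve K).geomPoints),
      (⟨0, a, 0, b, 0⟩ : WeierstrassCurve K).j = W.j ∧
      (∀ σ : Field.absoluteGaloisGroup K, ∀ P ∈ C, σ • P ∈ C) ∧ IsAddCyclic C ∧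
        Nat.card C = 2 ^ k ∧
        ∀ P ∈ C, 2 • P = 0 → P ≠ 0 →
          P = (⟨0, a, 0, b, 0⟩ : WeierstrassCurve K).geomTwoTorsionPoint := by
  -- the kernel `C₀ = E[ψ]`: cyclic of order `2ᵏ`, `Γ_K`-stable
  haveI : IsAddCyclic ψ.toAddMonoidHom.ker := hcyc
  haveI : Finite ψ.toAddMonoidHom.ker := ψ.finite_ker'
  have hcard₀ : Nat.card ψ.toAddMonoidHom.ker = 2 ^ k := hdeg
  have hst₀ : ∀ σ : Field.absoluteGaloisGroup K, ∀ P ∈ ψ.toAddMonoidHom.ker,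
      σ • P ∈ ψ.toAddMonoidHom.ker := fun σ P hP ↦ by
    rw [AddMonoidHom.mem_ker, Isogeny.coe_toAddMonoidHom] at hP ⊢
    rw [ψ.map_smul, hP, smul_zero]
  -- its unique element `T₀` of order `2`, which is `Γ_K`-fixed
  obtain ⟨T₀, hT₀C, h2T₀, hT₀0⟩ :=
    exists_two_nsmul_eq_zero_of_card_eq ψ.toAddMonoidHom.ker hk hcard₀
  have huniq : ∀ P ∈ ψ.toAddMonoidHom.ker, 2 • P = 0 → P ≠ 0 → P = T₀ := fun P hP h2P hP0 ↦
    eq_of_two_nsmul_eq_zero_of_isAddCyclic ψ.toAddMonoidHom.ker hP hT₀C h2P hP0 h2T₀ hT₀0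
  have hfix : ∀ σ : Field.absoluteGaloisGroup K, σ • T₀ = T₀ := fun σ ↦
    huniq _ (hst₀ σ _ hT₀C) (by rw [smul_comm, h2T₀, smul_zero])
      ((smul_ne_zero_iff_ne σ).mpr hT₀0)
  -- hence `K`-rational: `T₀ = T = (x₀, y₀)` with `2T = O`, `y₀ = -y₀ - a₁x₀ - a₃`
  obtain ⟨T, hT⟩ := exists_toGeomPoints_eq_of_forall_smul_eq W hfix
  subst hT
  rcases T with _ | ⟨x₀, y₀, h₀⟩
  · exact absurd (map_zero _) hT₀0
  have h2T : 2 • (Affine.Point.some x₀ y₀ h₀ : W.toAffine.Point) = 0 :=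
    W.toGeomPoints_injective (by rw [map_nsmul, h2T₀, map_zero])
  have hy₀ : y₀ = W.toAffine.negY x₀ y₀ := by
    by_contra hy
    apply Affine.Point.some_ne_zero (Affine.nonsingular_add h₀ h₀ fun hxy ↦ hy hxy.right)
    rw [← Affine.Point.add_self_of_Y_ne (h₁ := h₀) hy, ← two_nsmul, h2T]
  -- the normal form `V = Cv • W` and the isomorphism `ι : W ≅ V`, with `ι T₀ = (0, 0)`
  set Cv : VariableChange K := ⟨1, x₀, -W.a₁ / 2, y₀⟩ with hCv
  haveI : (Cv • W).IsTwoTorsionNF := isTwoTorsionNF_smul_of_two_nsmul_eq_zero htwo h₀ hy₀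
  have hTT : VariableChange.toIsogeny W Cv (W.toGeomPoints (Affine.Point.some x₀ y₀ h₀)) =
      (Cv • W).geomTwoTorsionPoint := by
    obtain ⟨hns, e₀⟩ : ∃ hns, W.toGeomPoints (Affine.Point.some x₀ y₀ h₀) =
        Affine.Point.some (algebraMap K (AlgebraicClosure K) x₀)
          (algebraMap K (AlgebraicClosure K) y₀) hns := ⟨_, rfl⟩
    rw [e₀, VariableChange.toIsogeny_some]
    have hx : (Cv.map (algebraMap K (AlgebraicClosure K))).toX
        (algebraMap K (AlgebraicClosure K) x₀) = 0 := by
      simp [hCv, VariableChange.toX_def, VariableChange.map]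
    have hy : (Cv.map (algebraMap K (AlgebraicClosure K))).toY
        (algebraMap K (AlgebraicClosure K) x₀) (algebraMap K (AlgebraicClosure K) y₀) = 0 := by
      simp [hCv, VariableChange.toY_def, VariableChange.map]
    obtain ⟨h', e'⟩ := UnivEC.some_eq_some_of_eq hx hy
      ((VariableChange.baseChange_smul_eq W Cv (AlgebraicClosure K)) ▸
        (VariableChange.nonsingular_iff (W.baseChange (AlgebraicClosure K))
          (Cv.map (algebraMap K (AlgebraicClosure K))) _ _).mpr hns)
    exact e'
  -- transport of the kernel along `ι`
  have hinj : Function.Injective (VariableChange.toIsogeny W Cv).toAddMonoidHom :=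
    VariableChange.toIsogeny_injective W Cv
  have hjW : (Cv • W).j = W.j := by rw [variableChange_j]
  rw [← hjW]
  refine exists_literal_j_of_isTwoTorsionNF (Cv • W)
    (ψ.toAddMonoidHom.ker.map (VariableChange.toIsogeny W Cv).toAddMonoidHom) k
    ?_ ?_ ?_ ?_
  · rintro σ P ⟨Q, hQ, rfl⟩
    exact AddSubgroup.mem_map.mpr ⟨σ • Q, hst₀ σ Q hQ, (VariableChange.toIsogeny W Cv).map_smul σ Q⟩
  · exact isAddCyclic_of_surjective _ (ψ.toAddMonoidHom.ker.equivMapOfInjective _ hinj).surjective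
  · exact (Nat.card_congr (ψ.toAddMonoidHom.ker.equivMapOfInjective _ hinj).toEquiv).symm.trans
      hcard₀
  · rintro P ⟨Q, hQ, rfl⟩ h2P hP0
    have h2Q : 2 • Q = 0 := hinj (by rw [map_nsmul, map_zero]; exact h2P)
    have hQ0 : Q ≠ 0 := by
      rintro rfl
      exact hP0 (map_zero _)
    rw [huniq Q hQ h2Q hQ0]
    exact hTT

/-! ### The reduction of level `20` to the fibre product `X₀(4) ×_{X(1)} X₀(5)` -/

/-- `j` of `y² = x³ + ax² + d²x` (elliptic): `d ≠ 0`, `a² ≠ 4d²` and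
`j · d⁴(a² − 4d²) = 256 (a² − 3d²)³` (`c₄ = 16(a² − 3d²)`, `Δ = 16d⁴(a² − 4d²)`, `j = c₄³/Δ`).
[cite: SilvermanAEC2009, III.1 (j = c₄³/Δ)] -/
theorem j_twoTorsionNF_sq (a d : ℚ) [hE : (⟨0, a, 0, d ^ 2, 0⟩ : WeierstrassCurve ℚ).IsElliptic] :
    d ≠ 0 ∧ a ^ 2 ≠ 4 * d ^ 2 ∧
      (⟨0, a, 0, d ^ 2, 0⟩ : WeierstrassCurve ℚ).j * (d ^ 4 * (a ^ 2 - 4 * d ^ 2)) =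
        256 * (a ^ 2 - 3 * d ^ 2) ^ 3 := by
  set V : WeierstrassCurve ℚ := ⟨0, a, 0, d ^ 2, 0⟩ with hV
  have h4 := WeierstrassCurve.a₄_ne_zero V
  have h2 := WeierstrassCurve.a₂_sq_sub_ne_zero V
  simp only [hV] at h4 h2
  have hd : d ≠ 0 := fun h ↦ h4 (by rw [h]; ring)
  have ha : a ^ 2 ≠ 4 * d ^ 2 := fun h ↦ h2 (by rw [h]; ring)
  refine ⟨hd, ha, ?_⟩
  have hΔ : V.Δ = 16 * (d ^ 2) ^ 2 * (a ^ 2 - 4 * d ^ 2) := Δ_of_isTwoTorsionNF V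
  have hc₄ : V.c₄ = 16 * (a ^ 2 - 3 * d ^ 2) := by
    simp only [hV, WeierstrassCurve.c₄, WeierstrassCurve.b₂, WeierstrassCurve.b₄]
    ring
  have hΔ0 : V.Δ ≠ 0 := by
    rw [← V.coe_Δ']
    exact V.Δ'.ne_zero
  have hj : V.j = V.c₄ ^ 3 / V.Δ := by
    rw [WeierstrassCurve.j, Units.val_inv_eq_inv_val, WeierstrassCurve.coe_Δ', div_eq_inv_mul]
  have hΔ0' : 16 * (d ^ 2) ^ 2 * (a ^ 2 - 4 * d ^ 2) ≠ 0 := hΔ ▸ hΔ0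
  rw [hj, hc₄, hΔ, div_mul_eq_mul_div, div_eq_iff hΔ0']
  ring

/-- **Kenku's level `20`, step 1.** A cyclic `ℚ`-isogeny of degree `20` out of an elliptic curve
over `ℚ` yields rational `s, t` with `t ≠ 0`, `s² ≠ 4` and
`256 t (s² − 3)³ = (s² − 4)(t² + 10t + 5)³` — an affine rational point, off the cusps, of the
fibre product of the `j`-maps of `X₀(4)` (`s ↦ 256(s² − 3)³/(s² − 4)`, from the `j`-preserving
two-torsion normal form of the cyclic degree-`4` part and the vertex criterion) and of `X₀(5)`
(Klein–Fricke `t ↦ (t² + 10t + 5)³/t`). [cite: Kenku1982, proof of Thm. 1, level 20]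
[cite: SilvermanAEC2009, III.4 Example 4.5] -/
theorem exists_fibreProduct_point_of_isCyclic_degree_twenty {V V' : WeierstrassCurve ℚ}
    [V.IsElliptic] [V'.IsElliptic] (ψ : Isogeny V V') (hψ : ψ.IsCyclic) (hdeg : ψ.degree = 20) :
    ∃ s t : ℚ, t ≠ 0 ∧ s ^ 2 ≠ 4 ∧
      256 * t * (s ^ 2 - 3) ^ 3 = (s ^ 2 - 4) * (t ^ 2 + 10 * t + 5) ^ 3 := by
  -- the cyclic degree-`4` part, in `j`-preserving two-torsion normal form, with `b = d²`
  obtain ⟨V₂, hV₂, ψ₄, hψ₄c, hψ₄d, -⟩ :=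
    ψ.exists_isCyclic_degree_eq_of_dvd hψ (d := 4) (hdeg ▸ (by norm_num : (4 : ℕ) ∣ 20))
  haveI := hV₂
  obtain ⟨a, b, hE, C, hj, hst, hcyc, hcard, h2⟩ :=
    exists_twoTorsionNF_j_eq_of_isCyclic_isogeny two_ne_zero V V₂ ψ₄ (k := 2) (by norm_num)
      hψ₄c (by rw [hψ₄d]; norm_num)
  haveI := hE
  obtain ⟨d, rfl⟩ := twoVertex_exists_sq (⟨0, a, 0, b, 0⟩ : WeierstrassCurve ℚ) C (k := 2) le_rfl
    hst hcyc hcard h2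
  obtain ⟨hd, ha, hjE⟩ := j_twoTorsionNF_sq a d
  -- the degree-`5` part: Klein–Fricke
  obtain ⟨t, ht, hjt⟩ :=
    ψ.exists_j_eq_klein_five_of_five_dvd_degree hψ (hdeg ▸ (by norm_num : (5 : ℕ) ∣ 20))
  have hsq : d ^ 2 * (a / d) ^ 2 = a ^ 2 := by field_simp
  refine ⟨a / d, t, ht, ?_, ?_⟩
  · intro h
    exact ha (by rw [← hsq, h]; ring)
  · rw [hj, hjt] at hjE
    have key : (t ^ 2 + 10 * t + 5) ^ 3 * (d ^ 4 * (a ^ 2 - 4 * d ^ 2)) =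
        256 * (a ^ 2 - 3 * d ^ 2) ^ 3 * t := by
      rw [div_mul_eq_mul_div, div_eq_iff ht] at hjE
      exact hjE
    have hd6 : d ^ 6 ≠ 0 := pow_ne_zero 6 hd
    apply mul_left_cancel₀ hd6
    calc d ^ 6 * (256 * t * ((a / d) ^ 2 - 3) ^ 3)
        = 256 * t * (d ^ 2 * (a / d) ^ 2 - 3 * d ^ 2) ^ 3 := by ring
      _ = 256 * t * (a ^ 2 - 3 * d ^ 2) ^ 3 := by rw [hsq]
      _ = d ^ 4 * (a ^ 2 - 4 * d ^ 2) * (t ^ 2 + 10 * t + 5) ^ 3 := by linear_combination -key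
      _ = d ^ 4 * (d ^ 2 * (a / d) ^ 2 - 4 * d ^ 2) * (t ^ 2 + 10 * t + 5) ^ 3 := by rw [hsq]
      _ = d ^ 6 * (((a / d) ^ 2 - 4) * (t ^ 2 + 10 * t + 5) ^ 3) := by ring

/-! ### Level `20` -/

/-- **STUB `stub_levelTwenty`: no cyclic `ℚ`-isogeny of degree `20`** (Kenku's level `20`,
`Y₀(20)(ℚ) = ∅` — Ligozat 1975 / Kenku 1982 — WITHOUT modular curves): the reduction
`exists_fibreProduct_point_of_isCyclic_degree_twenty` and the Diophantine end
`stub_levelTwentyNoPoint`. [cite: Kenku1982, proof of Thm. 1, level 20] [cite: Ligozat1975] -/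
theorem stub_levelTwenty :
    ∀ (V V' : WeierstrassCurve ℚ) [V.IsElliptic] [V'.IsElliptic] (ψ : Isogeny V V'),
      ψ.IsCyclic → ψ.degree ≠ 20 := by
  intro V V' _ _ ψ hψ h20
  obtain ⟨s, t, ht, hs, hP⟩ := exists_fibreProduct_point_of_isCyclic_degree_twenty ψ hψ h20
  exact stub_levelTwentyNoPoint s t ht hs hP

/-- **The Literature named fact `isogeny_isCyclic_degree_ne_twenty` HOLDS** (Kenku 1982, level
`20`; the only modular-curve input `h20` of the line `Sketch` of crux stmt-ABC-11340,
`freyModularity_of_CDT721_CDT722_switch_degreeNeTwenty`). Proved Summits-side because its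
two-chain inputs (`stub_twoVertex`, the `j`-preserving normal form) live under `Summits/…/Theorems`.
[cite: Kenku1982, Thm. 1] -/
theorem isogeny_isCyclic_degree_ne_twenty_holds :
    Literature.NumberTheory.EllipticCurves.isogeny_isCyclic_degree_ne_twenty :=
  fun W₁ W₂ _ _ φ hφ ↦ stub_levelTwenty W₁ W₂ φ hφ

end Summit.ABC.ABC.Theorems

end
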